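import Summits.QuantumFields.YangMills.Theorems.UnitScaleTiltProp7FlatFrameResponseT3
import Summits.QuantumFields.YangMills.Theorems.UnitScaleTiltProp7SymAvgTwBridge
import Summits.QuantumFields.YangMills.Theorems.UnitScaleTiltProp7QSymFlat
import Summits.QuantumFields.YangMills.Theorems.UnitScaleTiltProp7SymAvgTwSymDefs
import Summits.QuantumFields.YangMills.Theorems.UnitScaleTiltProp8ChartHInvComb
import HarnessLib

/-!
# Route `UnitScaleTilt`, crux «MinimiserStabilityRegPr» (stmt-QuantumFields-19200), route-R E′ (A′)-comb, open flat lemma «COMB-FLAT COERCIVITY» (★★OWNER RULING g29-№17 (2)),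
# brick (I2)-B of ★px6 g5's LOCATE-COMBFLAT §7 «σ EXPLICIT»: **PRINT'S COMB AVERAGING OPERATOR `Q(1) = QTw 1` AT THE FLAT MEMBER, EXPLICIT IN EVERY DIRECTION** —
# `QTw 1 X (c) = Q^{(K−n)}X(ĉ) − (r₁X(c₋) − r₁X(c₊))` with `Q^{(k)}` the iterated linear (0.4)-average (✓`Prop7QSymFlat.QSym_one_apply`) and `r₁ = d(frameTw 1)₀` the flat frame
# response (✓`Prop7FlatFrameResponse.fderiv_frameTw_one_apply`): the bridge ✓`Prop7SymAvgTwBridge.QTw_apply_eq` with BOTH differentiability rows DISCHARGED at `U₀ = 1`;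
# hence `QTw 1 X = L^{K−n}·Q_{K−n}X − d(Λ − r₁)X` — the coarse pure gauge `σ := Λ − r₁` separating the comb average from the tube ✓`QTwS_one_apply`, written out

Cell `ym3-torus` (HUMAN RULING D-0037, YM ladder rung R3 — YM₃ on T³ is a rung, NOT d = 4, NOT infinite volume, NOT a mass gap, NOT Clay; YM gap NOT proved), width seat
`ym3-torus-px21` (gen 6; FILL-TO-CAP «width 21»).  THEOREMS ONLY (0 `def`, 0 `sorry`); `--supports stmt-QuantumFields-19200 --as helper`; count-neutral.  Nothing here is a claim
about the stub, the crux or any summit statement.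

THE PRINT.  [Balaban1985BackgroundPropagators] p. 392–393: *«the averaging operation used here is the operation U̿ʲ defined by the formulas (89)–(92) of [5] … (1/η_j)Q_j(U, ηA) = Q_j(U)A
+ C_j(U, A), (3.14) where Q_j(U)A is a linear part of the function (3.13)»*.  [Balaban1985Averaging] (89) p. 31 (the double-bar average with the frames `\overline{R_{0,c±}U₁}`), (125)–(127)
pp. 36–37 (the linear parts), (160) p. 42 (the accumulated frames `v_k`); [Balaban1984PropagatorsI] (1.18)–(1.20) p. 20 (`Q_k`, `Q_k∂ = ∂Q′_k`).  At `U = 1` print does not display `Q_j(1)`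
for the double-bar averaging as a formula; this file does, for the route's twisted symmetric chart of record ✓`Prop7SymAvgTw.QTw`.

WHY (bus 2026-08-29 03:33–04:25Z).  RULING №17 (2)'s open flat lemma COMB-FLAT COERCIVITY is reduced by ★px6 g5 (✓p694021 `coercive_laplaceAc_one_of_sliceBound`) to (I1) (px6's pen) and the
displayed row (hv) = (I3) «`a‖(Qkc 1 − Qk 1) y‖² ≤ ρ_L·T(y)`», whose object is `QTw 1 − QTwS 1 = −d∘σ`.  ✓p695582 made `r₁` explicit; this file makes `QTw 1` itself explicit (item (I2)
of px6's LOCATE §7, second half: «σ explicit»), so that (I3)'s pen ∕ the explicit-filling LOCATE of w4-19200 g8 start from a kernel formula for the weight chain, and px22 g4's T-rows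
(№17 (3) falsifier, kit j324523) have their kernel statement; under ★★OWNER RULING №18 (04:26Z) the same difference carries the gradient-blind `δQ` of the named sub-lemma (I3′)
«δQ-SLICE».  General direction `X` ONLY — the gauge specialisation `QTw 1 (D(1)λ)` is ★px6 g5's (I1b) and is NOT stated here.

WHAT IS PROVED (ns `…Theorems.Prop7QTwFlatExplicit`; member `F : T3Family`, `n ≤ K`, `k = K − n`, `ĉ = bondShift (sites_eq F n K h) c`, `X♯ z κ = X⟨x₀ + z, κ⟩`, `ŷ = coordT3 y`;
`Q` any family with `Q⁽⁰⁾ = id`, `Q⁽ⁱ⁺¹⁾ = linAvg ∘ Q⁽ⁱ⁾`; `Λ` any family with `Λ₀ = 0`, `Λ_{i+1}(Y)(y) = Lⁱ·λ̄(Q_iY)(y) + Λ_i(Y)(emb y)` — the letters of ✓`Prop7QSymFlat` ∕ ✓`Prop8ChartHInvComb`).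
* §1 ★ `exists_hasFDerivAt_rel_one` — the bridge's row `hG` AT THE FLAT MEMBER: the relative descended perturbation `A ↦ (c ↦ D̄(e^{A}·1)(c)·D̄(1)(c)⁻¹)` has a Fréchet derivative `G′` at `0`
  with `G′ Y c = Q⁽ᵏ⁾ Y ĉ` (✓`Prop7QSymFlat.exists_hasFDerivAt_coe_emlIterU_expUnit_zero` per bond, `descendToGL_one`); ★★ `differentiableAt_logChartTw_one` — `logChartTw 1` is
  differentiable at `0`, NO hypothesis (the `hQ` of ★px6 g5's `Prop7CombChartFlatPureGauge.QTw_one_gaugeDir`, discharged).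
* §2 ★★★ `QTw_one_apply_fderiv` — `QTw 1 X c = QSym 1 X c − (r c.src X − r c.tgt X)`, `r y := fderiv ℂ (A ↦ ↑(frameTw 1 A y)) 0` (the bridge ✓`QTw_apply_eq` at `U₀ = 1` with `hG` := §1,
  `hr` := ✓`Prop7FlatFrameResponse.hasFDerivAt_frameTw_one`; the conjugation by `D̄(1)(c) = 1` drops).
* §3 ★★★ `QTw_one_apply` — THE EXPLICIT FORMULA: `QTw 1 X c = Q⁽ᵏ⁾ X ĉ − (Σ_{j<k} F̂(L^{k−j}·ĉ₋^)[LʲQ_jX♯] − Σ_{j<k} F̂(L^{k−j}·ĉ₊^)[LʲQ_jX♯])` (§2 ∘ ✓`QSym_one_apply` ∘ ✓`fderiv_frameTw_one_apply`).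
* §4 ★★ `QTw_one_eq_tube_sub_coarseGrad` — `QTw 1 X c = Lᵏ·(Q_kX)(ĉ) − ((Λ_k X ĉ₊ − Λ_k X ĉ₋) + (r₁X c₋ − r₁X c₊))` (✓`ChartHInv.linFamily_eq_sub_comb`), and
  ★★ `QTwS_one_sub_QTw_one_apply` — `QTwS 1 X c − QTw 1 X c = (Λ_k X ĉ₊ − Λ_k X ĉ₋) + (r₁X c₋ − r₁X c₊)` (✓`QTwS_one_apply`): the comb-minus-tube defect IS the coarse gradient of
  `σ := Λ_k X ∘ (·̂) − r₁X`, both summands explicit.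
HONEST SCOPE.  Flat background only; composition of landed identities (no estimate beyond what ✓p695582 carries); nothing of (I1)∕(I3)∕COMB-FLAT COERCIVITY∕A6ᶜ∕N06∕EX∕the crux;
nothing continuum ∕ OS ∕ mass-gap ∕ Clay.

References: T. Bałaban, CMP **99** (1985) 389–434 [Balaban1985BackgroundPropagators] (p.392, (3.13)–(3.15) p.393); CMP **98** (1985) 17–51 [Balaban1985Averaging] ((89)–(92) p.31, (124)–(127)
pp.36–37, (160) p.42, (62) p.28); CMP **95** (1984) 17–40 [Balaban1984PropagatorsI] ((1.18)–(1.20) p.20); CMP **102** (1985) 277–309 [Balaban1985Variational] ((44) p.285).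
-/

set_option autoImplicit false

noncomputable section

open scoped Matrix.Norms.L2Operator Topology BigOperators

namespace Summit.QuantumFields.YangMills.Theorems.Prop7QTwFlatExplicit

open NormedSpace Filter
open Literature.MathematicalPhysics.QuantumFieldTheory.Balaban1983to89
open Literature.MathematicalPhysics.QuantumFieldTheory.Balaban1983to89.T3ContinuumYM3Torus
open T3SectALandauChart (bgUnits)
open T3LevelShift (bondShift)
open T3PrintedRegularOrbits (sites_eq)
open B7Prop1Explicit renaming Site → LSite
open B7Prop1Explicit (expUnit)
open B7Prop3Flat (Fhat)
open B7Prop4Flat (linQIter)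
open B10Eq27TorusAxialLog (transl)
open T4Continuum BlockAveraging LatticeFieldCalculus
open BlockAveragingEMLLinearised (linAvg combMean)
open Summit.QuantumFields.YangMills.Theorems.Prop8Chart (emlIterU)
open Summit.QuantumFields.YangMills.Theorems.Prop7SPrint (basePt)
open Summit.QuantumFields.YangMills.Theorems.Prop7SymAvgGL (descendToGL QSym descendToGL_eq_fieldShift_emlIterU)
open Summit.QuantumFields.YangMills.Theorems.Prop7SymAvgTw (coordT3 frameTw logChartTw QTw)
open Summit.QuantumFields.YangMills.Theorems.Prop7SymAvgTwSym (QTwS QTwS_one_apply)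
open Summit.QuantumFields.YangMills.Theorems.Prop7SymAvgTwBridge (QTw_apply_eq hasFDerivAt_logChartTw)
open Summit.QuantumFields.YangMills.Theorems.Prop7QSymFlat (expUnit_mul_bgUnits_one descendToGL_one exists_hasFDerivAt_coe_emlIterU_expUnit_zero QSym_one_apply)
open Summit.QuantumFields.YangMills.Theorems.Prop7FlatFrameResponse (hasFDerivAt_frameTw_one fderiv_frameTw_one_apply)
open Summit.QuantumFields.YangMills.Theorems.ChartHInv (linFamily_eq_sub_comb)

variable (F : T3Family) {n K : ℕ} (h : n ≤ K)

/-! ## §1 The bridge's row `hG` at the flat member -/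

/-- ★ **`hG` AT `U₀ = 1`**: the relative descended perturbation `A ↦ (c ↦ D̄(e^{A}·1)(c) · D̄(1)(c)⁻¹)` — the argument of `logChartSym 1` — has a Fréchet derivative `G′` at `A = 0`, and
`G′ Y c = Q⁽ᴷ⁻ⁿ⁾ Y ĉ` for every `(J5)`-family `Q` (per coarse bond: ✓`exists_hasFDerivAt_coe_emlIterU_expUnit_zero`; `D̄(1) = 1` by ✓`descendToGL_one`).
[cite: Balaban1985Averaging, Prop. 3 (124)–(125) p.36; Balaban1985Variational, (44) p.285; Balaban1987RG1, (0.4) p.253] -/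
theorem exists_hasFDerivAt_rel_one
    (Q : (i : ℕ) → (PBond (F.P K) 0 → Matrix (Fin 2) (Fin 2) ℂ) → PBond (F.P K) i → Matrix (Fin 2) (Fin 2) ℂ)
    (hQ0 : ∀ Y, Q 0 Y = Y)
    (hQs : ∀ (i : ℕ) (Y : PBond (F.P K) 0 → Matrix (Fin 2) (Fin 2) ℂ) (c : PBond (F.P K) (i + 1)), Q (i + 1) Y c = linAvg (Q i Y) c) :
    ∃ G' : (PBond (F.P K) 0 → Matrix (Fin 2) (Fin 2) ℂ) →L[ℂ] (PBond (F.P n) 0 → Matrix (Fin 2) (Fin 2) ℂ),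
      HasFDerivAt (fun A : PBond (F.P K) 0 → Matrix (Fin 2) (Fin 2) ℂ => fun c : PBond (F.P n) 0 =>
          ((descendToGL F n K h (fun b => expUnit (A b) * bgUnits F K (1 : GaugeField (F.P K) 0 (Matrix.specialUnitaryGroup (Fin 2) ℂ)) b) c : (Matrix (Fin 2) (Fin 2) ℂ)ˣ) :
              Matrix (Fin 2) (Fin 2) ℂ)
            * (((descendToGL F n K h (bgUnits F K (1 : GaugeField (F.P K) 0 (Matrix.specialUnitaryGroup (Fin 2) ℂ))) c)⁻¹ : (Matrix (Fin 2) (Fin 2) ℂ)ˣ) :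
              Matrix (Fin 2) (Fin 2) ℂ)) G' 0 ∧
        ∀ (Y : PBond (F.P K) 0 → Matrix (Fin 2) (Fin 2) ℂ) (c : PBond (F.P n) 0), G' Y c = Q (K - n) Y (bondShift (sites_eq F n K h) c) := by
  choose D hD hDQ using fun c : PBond (F.P n) 0 =>
    exists_hasFDerivAt_coe_emlIterU_expUnit_zero (P := F.P K) (m := Fin 2) Q hQ0 hQs (K - n) (bondShift (sites_eq F n K h) c)
  refine ⟨ContinuousLinearMap.pi fun c : PBond (F.P n) 0 => D c, ?_, fun Y c => ?_⟩
  · apply hasFDerivAt_pi''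
    intro c
    -- the `c`-component is `A ↦ ↑(Ū^{(K−n)}(e^{A}))(ĉ)` (the reference factor `D̄(1)(c)⁻¹ = 1` drops)
    have hfun : (fun A : PBond (F.P K) 0 → Matrix (Fin 2) (Fin 2) ℂ =>
        ((descendToGL F n K h (fun b => expUnit (A b) * bgUnits F K (1 : GaugeField (F.P K) 0 (Matrix.specialUnitaryGroup (Fin 2) ℂ)) b) c : (Matrix (Fin 2) (Fin 2) ℂ)ˣ) :
              Matrix (Fin 2) (Fin 2) ℂ)
            * (((descendToGL F n K h (bgUnits F K (1 : GaugeField (F.P K) 0 (Matrix.specialUnitaryGroup (Fin 2) ℂ))) c)⁻¹ : (Matrix (Fin 2) (Fin 2) ℂ)ˣ) :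
              Matrix (Fin 2) (Fin 2) ℂ))
        = fun A => ((emlIterU (K - n) (fun b : PBond (F.P K) 0 => expUnit (A b)) (bondShift (sites_eq F n K h) c) : (Matrix (Fin 2) (Fin 2) ℂ)ˣ) : Matrix (Fin 2) (Fin 2) ℂ) := by
      funext A
      rw [expUnit_mul_bgUnits_one, Prop7QSymFlat.bgUnits_one, descendToGL_one, descendToGL_eq_fieldShift_emlIterU, T3LevelShift.fieldShift_apply, inv_one, Units.val_one, mul_one]
      rfl
    rw [hfun]
    exact hD c
  · rw [ContinuousLinearMap.pi_apply, hDQ]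

/-- ★★ **THE TWISTED LOG-CHART IS DIFFERENTIABLE AT `0` AT THE FLAT MEMBER — NO HYPOTHESIS**: `DifferentiableAt ℂ (logChartTw 1) 0` (✓`Prop7SymAvgTwBridge.hasFDerivAt_logChartTw` with
`hG` := §1 and `hr` := ✓`Prop7FlatFrameResponse.hasFDerivAt_frameTw_one`), so `QTw 1 := fderiv (logChartTw 1) 0` is a genuine derivative; discharges the displayed `hQ` of ★px6 g5's
`Prop7CombChartFlatPureGauge.QTw_one_gaugeDir`. [cite: Balaban1985BackgroundPropagators, (3.13)–(3.14) p.393; Balaban1985Averaging, (89) p.31, Prop. 6 p.43] -/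
theorem differentiableAt_logChartTw_one : DifferentiableAt ℂ (logChartTw F n K h 1) 0 := by
  obtain ⟨G', hG, -⟩ := exists_hasFDerivAt_rel_one F h
    (fun i => Nat.rec (motive := fun i => (PBond (F.P K) 0 → Matrix (Fin 2) (Fin 2) ℂ) → PBond (F.P K) i → Matrix (Fin 2) (Fin 2) ℂ) (fun Y => Y)
      (fun _ Qi Y c => linAvg (Qi Y) c) i) (fun _ => rfl) (fun _ _ _ => rfl)
  exact (hasFDerivAt_logChartTw F h (1 : GaugeField (F.P K) 0 (Matrix.specialUnitaryGroup (Fin 2) ℂ)) hG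
    (r := fun y => fderiv ℂ (fun A : PBond (F.P K) 0 → Matrix (Fin 2) (Fin 2) ℂ => ((frameTw F n K h 1 A y : (Matrix (Fin 2) (Fin 2) ℂ)ˣ) : Matrix (Fin 2) (Fin 2) ℂ)) 0)
    (fun y => hasFDerivAt_frameTw_one F h y)).differentiableAt

/-! ## §2 ★★★ `QTw 1` through the linearised frames -/

/-- ★★★ **PRINT'S `Q(1)` FOR THE TWISTED SYMMETRIC CHART, VIA THE FRAMES**: at the flat member, for every direction `X` and coarse bond `c`,
`QTw 1 X c = QSym 1 X c − (r c.src X − r c.tgt X)` with `r y := fderiv ℂ (A ↦ ↑(frameTw 1 A y)) 0` — ✓`Prop7SymAvgTwBridge.QTw_apply_eq` with `hG` := §1 and `hr` := ✓`hasFDerivAt_frameTw_one`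
(NO regularity hypothesis at `U₀ = 1`), the conjugation by `Ū₀(c) = D̄(1)(c) = 1` being trivial. [cite: Balaban1985BackgroundPropagators, (3.14) p.393; Balaban1985Averaging, (89) p.31, p.28] -/
theorem QTw_one_apply_fderiv (X : PBond (F.P K) 0 → Matrix (Fin 2) (Fin 2) ℂ) (c : PBond (F.P n) 0) :
    QTw F n K h 1 X c = QSym F n K h 1 X c
      - (fderiv ℂ (fun A : PBond (F.P K) 0 → Matrix (Fin 2) (Fin 2) ℂ => ((frameTw F n K h 1 A c.src : (Matrix (Fin 2) (Fin 2) ℂ)ˣ) : Matrix (Fin 2) (Fin 2) ℂ)) 0 X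
        - fderiv ℂ (fun A : PBond (F.P K) 0 → Matrix (Fin 2) (Fin 2) ℂ => ((frameTw F n K h 1 A c.tgt : (Matrix (Fin 2) (Fin 2) ℂ)ˣ) : Matrix (Fin 2) (Fin 2) ℂ)) 0 X) := by
  -- a `(J5)`-family for `hG`
  obtain ⟨G', hG, -⟩ := exists_hasFDerivAt_rel_one F h
    (fun i => Nat.rec (motive := fun i => (PBond (F.P K) 0 → Matrix (Fin 2) (Fin 2) ℂ) → PBond (F.P K) i → Matrix (Fin 2) (Fin 2) ℂ) (fun Y => Y)
      (fun _ Qi Y c => linAvg (Qi Y) c) i) (fun _ => rfl) (fun _ _ _ => rfl)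
  have hb := QTw_apply_eq F h (1 : GaugeField (F.P K) 0 (Matrix.specialUnitaryGroup (Fin 2) ℂ)) hG
    (r := fun y => fderiv ℂ (fun A : PBond (F.P K) 0 → Matrix (Fin 2) (Fin 2) ℂ => ((frameTw F n K h 1 A y : (Matrix (Fin 2) (Fin 2) ℂ)ˣ) : Matrix (Fin 2) (Fin 2) ℂ)) 0)
    (fun y => hasFDerivAt_frameTw_one F h y) X c
  rw [hb, Prop7QSymFlat.bgUnits_one, descendToGL_one, inv_one, Units.val_one, one_mul, mul_one]

/-! ## §3 ★★★ THE EXPLICIT FORMULA -/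

/-- ★★★ **`QTw 1` EXPLICIT IN EVERY DIRECTION**: for every `(J5)`-family `Q`, every `X`, every coarse bond `c`,
`QTw 1 X c = Q⁽ᴷ⁻ⁿ⁾ X ĉ − (Σ_{j<K−n} F̂(L^{K−n−j}·ŷ₋)[LʲQ_j X♯] − Σ_{j<K−n} F̂(L^{K−n−j}·ŷ₊)[LʲQ_j X♯])`, `ŷ± = coordT3 c.src∕c.tgt` — §2 ∘ ✓`QSym_one_apply` ∘ ✓`fderiv_frameTw_one_apply`.
[cite: Balaban1985BackgroundPropagators, (3.14) p.393; Balaban1985Averaging, (124)–(127) pp.36–37, (160) p.42, (110)–(112) p.34] -/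
theorem QTw_one_apply
    (Q : (i : ℕ) → (PBond (F.P K) 0 → Matrix (Fin 2) (Fin 2) ℂ) → PBond (F.P K) i → Matrix (Fin 2) (Fin 2) ℂ)
    (hQ0 : ∀ Y, Q 0 Y = Y)
    (hQs : ∀ (i : ℕ) (Y : PBond (F.P K) 0 → Matrix (Fin 2) (Fin 2) ℂ) (c : PBond (F.P K) (i + 1)), Q (i + 1) Y c = linAvg (Q i Y) c)
    (X : PBond (F.P K) 0 → Matrix (Fin 2) (Fin 2) ℂ) (c : PBond (F.P n) 0) :
    QTw F n K h 1 X c = Q (K - n) X (bondShift (sites_eq F n K h) c)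
      - (∑ j ∈ Finset.range (K - n), Fhat (F.P K).L (linQIter (F.P K).L (fun z κ => X ⟨transl (basePt F n K) z, κ⟩) j) ((((F.P K).L : ℤ) ^ (K - n - j)) • coordT3 F n K h c.src)
        - ∑ j ∈ Finset.range (K - n), Fhat (F.P K).L (linQIter (F.P K).L (fun z κ => X ⟨transl (basePt F n K) z, κ⟩) j) ((((F.P K).L : ℤ) ^ (K - n - j)) • coordT3 F n K h c.tgt)) := by
  rw [QTw_one_apply_fderiv, QSym_one_apply F h Q hQ0 hQs, fderiv_frameTw_one_apply, fderiv_frameTw_one_apply]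

/-! ## §4 `QTw 1 = L^k·Q_k − d(Λ − r₁)`: the comb-minus-tube defect as an explicit coarse gradient -/

/-- ★★ **`QTw 1 X c = Lᵏ·(Q_kX)(ĉ) − ((Λ_k X ĉ₊ − Λ_k X ĉ₋) + (r₁X c₋ − r₁X c₊))`**, `k = K − n` (the tube term in ✓`QTwS_one_apply`'s `ℂ`-scalar letter), for every comb-functional family `Λ` (`Λ₀ = 0`, `Λ_{i+1}(Y)(y) = Lⁱ·λ̄(Q_iY)(y) + Λ_i(Y)(emb y)`,
✓`ChartHInv.linFamily_eq_sub_comb`: `Q⁽ᵏ⁾Y = Lᵏ·Q_kY − dΛ_k(Y)`) and `r₁ = d(frameTw 1)₀` written out (§3): the comb average is the straight tube average [Balaban1984PropagatorsI] (1.18) minus the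
coarse gradient of `σ := Λ_k X(·̂) − r₁X`. [cite: Balaban1984PropagatorsI, (1.18)–(1.20) p.20; Balaban1985Averaging, (62) p.28, (124)–(127) pp.36–37, (160) p.42] -/
theorem QTw_one_eq_tube_sub_coarseGrad
    (Q : (i : ℕ) → (PBond (F.P K) 0 → Matrix (Fin 2) (Fin 2) ℂ) → PBond (F.P K) i → Matrix (Fin 2) (Fin 2) ℂ)
    (hQ0 : ∀ Y, Q 0 Y = Y)
    (hQs : ∀ (i : ℕ) (Y : PBond (F.P K) 0 → Matrix (Fin 2) (Fin 2) ℂ) (c : PBond (F.P K) (i + 1)), Q (i + 1) Y c = linAvg (Q i Y) c)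
    (Λ : (i : ℕ) → (PBond (F.P K) 0 → Matrix (Fin 2) (Fin 2) ℂ) → Site (F.P K) i → Matrix (Fin 2) (Fin 2) ℂ)
    (hΛ0 : ∀ Y y, Λ 0 Y y = 0)
    (hΛs : ∀ (i : ℕ) (Y : PBond (F.P K) 0 → Matrix (Fin 2) (Fin 2) ℂ) (y : Site (F.P K) (i + 1)),
      Λ (i + 1) Y y = ((F.P K).L ^ i : ℕ) • combMean (bondAvgIter i Y) y + Λ i Y (emb y))
    (X : PBond (F.P K) 0 → Matrix (Fin 2) (Fin 2) ℂ) (c : PBond (F.P n) 0) :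
    QTw F n K h 1 X c = ((((F.P K).L : ℕ) : ℂ) ^ (K - n)) • bondAvgIter (K - n) X (bondShift (sites_eq F n K h) c)
      - ((Λ (K - n) X (bondShift (sites_eq F n K h) c).tgt - Λ (K - n) X (bondShift (sites_eq F n K h) c).src)
        + (∑ j ∈ Finset.range (K - n), Fhat (F.P K).L (linQIter (F.P K).L (fun z κ => X ⟨transl (basePt F n K) z, κ⟩) j) ((((F.P K).L : ℤ) ^ (K - n - j)) • coordT3 F n K h c.src)
          - ∑ j ∈ Finset.range (K - n), Fhat (F.P K).L (linQIter (F.P K).L (fun z κ => X ⟨transl (basePt F n K) z, κ⟩) j) ((((F.P K).L : ℤ) ^ (K - n - j)) • coordT3 F n K h c.tgt))) := by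
  rw [QTw_one_apply F h Q hQ0 hQs, linFamily_eq_sub_comb Q hQ0 hQs Λ hΛ0 hΛs X (K - n), sub_sub]
  congr 1
  rw [← Nat.cast_pow]
  exact (Nat.cast_smul_eq_nsmul ℂ _ _).symm

/-- ★★ **THE COMB-MINUS-TUBE DEFECT AT THE FLAT MEMBER, EXPLICIT**: `QTwS 1 X c − QTw 1 X c = (Λ_k X ĉ₊ − Λ_k X ĉ₋) + (r₁X c₋ − r₁X c₊)` — the tube ✓`QTwS_one_apply` (`QTwS 1 = Lᵏ·Q_k`, NO
defect) against §4: the difference of the two averagings of record is the coarse gradient of the explicit site function `σ = Λ_k X(·̂) − r₁X` (the object of px6's (I3) ∕ (hv) of ✓p694021).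
[cite: Balaban1984PropagatorsI, (1.18) p.20; Balaban1985Averaging, (62) p.28, (125)–(127) pp.36–37, (160) p.42] -/
theorem QTwS_one_sub_QTw_one_apply
    (Q : (i : ℕ) → (PBond (F.P K) 0 → Matrix (Fin 2) (Fin 2) ℂ) → PBond (F.P K) i → Matrix (Fin 2) (Fin 2) ℂ)
    (hQ0 : ∀ Y, Q 0 Y = Y)
    (hQs : ∀ (i : ℕ) (Y : PBond (F.P K) 0 → Matrix (Fin 2) (Fin 2) ℂ) (c : PBond (F.P K) (i + 1)), Q (i + 1) Y c = linAvg (Q i Y) c)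
    (Λ : (i : ℕ) → (PBond (F.P K) 0 → Matrix (Fin 2) (Fin 2) ℂ) → Site (F.P K) i → Matrix (Fin 2) (Fin 2) ℂ)
    (hΛ0 : ∀ Y y, Λ 0 Y y = 0)
    (hΛs : ∀ (i : ℕ) (Y : PBond (F.P K) 0 → Matrix (Fin 2) (Fin 2) ℂ) (y : Site (F.P K) (i + 1)),
      Λ (i + 1) Y y = ((F.P K).L ^ i : ℕ) • combMean (bondAvgIter i Y) y + Λ i Y (emb y))
    (X : PBond (F.P K) 0 → Matrix (Fin 2) (Fin 2) ℂ) (c : PBond (F.P n) 0) :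
    QTwS F n K h 1 X c - QTw F n K h 1 X c
      = (Λ (K - n) X (bondShift (sites_eq F n K h) c).tgt - Λ (K - n) X (bondShift (sites_eq F n K h) c).src)
        + (∑ j ∈ Finset.range (K - n), Fhat (F.P K).L (linQIter (F.P K).L (fun z κ => X ⟨transl (basePt F n K) z, κ⟩) j) ((((F.P K).L : ℤ) ^ (K - n - j)) • coordT3 F n K h c.src)
          - ∑ j ∈ Finset.range (K - n), Fhat (F.P K).L (linQIter (F.P K).L (fun z κ => X ⟨transl (basePt F n K) z, κ⟩) j) ((((F.P K).L : ℤ) ^ (K - n - j)) • coordT3 F n K h c.tgt)) := by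
  rw [QTw_one_eq_tube_sub_coarseGrad F h Q hQ0 hQs Λ hΛ0 hΛs, QTwS_one_apply, sub_sub_cancel]

end Summit.QuantumFields.YangMills.Theorems.Prop7QTwFlatExplicit

end
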